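import Literature.Computability.AlgebraicComplexity.BI17BinaryCubicPolystableProofs
import HarnessLib

/-!
# A polystable family of binary quartics and the `(D, m) = (4, 2)` case of Bürgisser–Ikenmeyer
# 2017, Prop. 2.10

Sibling proof file of `Literature/Computability/AlgebraicComplexity/BI17FundamentalInvariantForms.lean`
(cell `val-lit`, DAG row BI2017-A), continuing `BI17QuadraticPolystableProofs.lean` (`D = 2`, `m ≤ 1`)
and `BI17BinaryCubicPolystableProofs.lean` (`(D, m) = (3, 2)`) towards the named fact
`Literature.Computability.AlgebraicComplexity.BI2017_prop_2_10` (P. Bürgisser, C. Ikenmeyer,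
*Fundamental invariants of orbit closures*, J. Algebra 477 (2017) = arXiv:1511.02927, Prop. 2.10:
"If `D > 1`, then almost all `w ∈ Sym^D ℂ^m` are polystable").

Here: the slice `(D, m) = (4, 2)` — **almost all binary quartics are polystable**
(`BI2017_prop_2_10_four_two : IsZariskiGeneric 4 (IsPolystable : MvPolynomial (Fin 2) ℂ → Prop)`,
test polynomial `A · Disc` with `Disc` the discriminant of the quartic, value `256` at `x⁴ + y⁴`), and
the exact residual `BI2017_prop_2_10_of_main''` (what is left of the fact: `m ≥ 3`, or binary forms of
degree `D ≥ 5` — the range where no explicit normal form exists; printed proof: Thm. 2.3 + Luna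
1973, NOT proved in the tree). HONEST PARTIAL, no strike.

§1 `isPolystable_quarticFamily` — every binary quartic of the shape `p (x⁴ + y⁴) + e x²y²` is
polystable (Kempf–Ness route of the tree: it is the polynomial shadow of a symmetric 4-tensor on
`ℂ²` with rigid, relabelling-invariant support — constant words and the 𝔖₄-orbit of the word `0011`
— so `isPolystable_tensorToPoly_of_rigid_of_relabel` applies; this is OUR intermediate step, in the
style of the printed proof of Cor. 2.9 via Prop. 2.8, not a statement of the source).

§2 `exists_linSubst_prod_four_lines` — four distinct lines `x − r_i y` are moved by an explicit
`M ∈ GL₂` (division-free: `diag(r₁ − r₃, r₂ − r₃) · [[r₂, 1], [r₁, 1]]`) to `c · x y (x + y) (p x + q y)`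
with `c p q ≠ 0`, `p ≠ q`; the ratio `q/p` is the cross-ratio of the roots.

§3 A binary quartic with `a ≠ 0` splits as `a ∏ (x − r_i y)` (Mathlib `IsAlgClosed.splits` for the
dehomogenised quartic, Vieta by comparing coefficients) and `Disc = a⁶ ∏_{i<j} (r_i − r_j)²`.

§4 `isPolystable_binaryQuartic`: `a · Disc ≠ 0` ⇒ four distinct roots ⇒ `M · f = c · x y (x+y)(p x + q y)`;
the polystable `Q_β = (x² − β² y²)(x² − β⁻² y²) = x⁴ − (β² + β⁻²) x²y² + y⁴` has normal form
`c₀ · x y (x + y)(p₀ x + q₀ y)` with `p₀ q = q₀ p` as soon as `(q − p) β⁴ − 2 (q + p) β² + (q − p) = 0`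
(equality of cross-ratios; such `β` exists, `IsAlgClosed.exists_root`, and is `≠ 0`, `β² ≠ ±1`), so
`f = M⁻¹ (μ M₀) · Q_β` (`μ⁴` absorbing the scalar) is polystable by `IsPolystable.linSubst_of_det_ne_zero`.

Everything is PROVED; no named facts, no `instance`, no `notation`; private plumbing `def`s: `w₀`,
`quarticTensor`, `quarticDisc`.

Honest framing: bookkeeping of classical invariant theory of binary forms inside the BIP
literature programme; nothing here bears on lower bounds or on `VP` versus `VNP`.

## References

* [BurgisserIkenmeyer2017] P. Bürgisser, C. Ikenmeyer, J. Algebra 477 (2017) = arXiv:1511.02927,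
  Prop. 2.10, Def. 2.7, Prop. 2.8, Cor. 2.9.
-/

noncomputable section

open MvPolynomial Matrix

namespace Literature.Computability.AlgebraicComplexity

namespace BinaryQuartic

/-! ### §1 The symmetric tensor of `p (x⁴ + y⁴) + 24 r x²y²` -/

/-- The word `0011`. [folklore] -/
private def w₀ : Fin 4 → Fin 2 := ![0, 0, 1, 1]

/-- The symmetric `4`-tensor on `ℂ²` with value `p` on the two constant words, `r` on the
`𝔖₄`-translates of `0011` (each counted with multiplicity `4 = |Stab|`), and `0` elsewhere.
[folklore] -/
private def quarticTensor (p r : ℂ) : (Fin 4 → Fin 2) → ℂ := fun j =>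
  (∑ i : Fin 2, if j = (fun _ : Fin 4 => i) then p else 0) +
    ∑ τ : Equiv.Perm (Fin 4), if j = w₀ ∘ τ then r else 0

/-- Unfolding. [folklore] -/
private theorem quarticTensor_apply (p r : ℂ) (j : Fin 4 → Fin 2) :
    quarticTensor p r j = (∑ i : Fin 2, if j = (fun _ : Fin 4 => i) then p else 0) +
      ∑ τ : Equiv.Perm (Fin 4), if j = w₀ ∘ τ then r else 0 := rfl

/-- **The polynomial shadow**: `tensorToPoly (quarticTensor p r) = p (x⁴ + y⁴) + 24 r x²y²`.
[folklore] -/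
private theorem tensorToPoly_quarticTensor (p r : ℂ) :
    tensorToPoly (quarticTensor p r) =
      C p * (X 0 ^ 4 + X 1 ^ 4) + C (24 * r) * (X 0 ^ 2 * X 1 ^ 2 : MvPolynomial (Fin 2) ℂ) := by
  rw [tensorToPoly_apply]
  have hsplit : ∀ j : Fin 4 → Fin 2,
      C (quarticTensor p r j) * ∏ k, (X (j k) : MvPolynomial (Fin 2) ℂ) =
        (∑ i : Fin 2, if j = (fun _ : Fin 4 => i) then C p * ∏ k, (X (j k) : MvPolynomial (Fin 2) ℂ)
          else 0) +
        ∑ τ : Equiv.Perm (Fin 4),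
          if j = w₀ ∘ τ then C r * ∏ k, (X (j k) : MvPolynomial (Fin 2) ℂ) else 0 := by
    intro j
    rw [quarticTensor_apply, map_add, add_mul, map_sum, map_sum, Finset.sum_mul, Finset.sum_mul]
    congr 1
    · refine Finset.sum_congr rfl fun i _ => ?_
      by_cases h : j = (fun _ : Fin 4 => i)
      · rw [if_pos h, if_pos h]
      · rw [if_neg h, if_neg h, map_zero, zero_mul]
    · refine Finset.sum_congr rfl fun τ _ => ?_
      by_cases h : j = w₀ ∘ τ
      · rw [if_pos h, if_pos h]
      · rw [if_neg h, if_neg h, map_zero, zero_mul]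
  simp_rw [hsplit]
  rw [Finset.sum_add_distrib, Finset.sum_comm]
  conv_lhs => arg 2; rw [Finset.sum_comm]
  congr 1
  · -- the power-sum part
    rw [mul_add]
    have h1 : ∀ i : Fin 2, (∑ j : Fin 4 → Fin 2,
        if j = (fun _ : Fin 4 => i) then C p * ∏ k, (X (j k) : MvPolynomial (Fin 2) ℂ) else 0) =
        C p * X i ^ 4 := by
      intro i
      rw [Finset.sum_ite_eq' Finset.univ (fun _ : Fin 4 => i), if_pos (Finset.mem_univ _),
        Fin.prod_const]
    simp_rw [h1]
    rw [Fin.sum_univ_two]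
  · -- the `𝔖₄`-orbit of `0011`: each of the `24` words contributes `r x²y²`
    have h2 : ∀ τ : Equiv.Perm (Fin 4), (∑ j : Fin 4 → Fin 2,
        if j = w₀ ∘ τ then C r * ∏ k, (X (j k) : MvPolynomial (Fin 2) ℂ) else 0) =
        C r * ∏ k, (X ((w₀ ∘ τ) k) : MvPolynomial (Fin 2) ℂ) := by
      intro τ
      rw [Finset.sum_ite_eq' Finset.univ (w₀ ∘ τ), if_pos (Finset.mem_univ _)]
    simp_rw [h2]
    have hw : ∀ τ : Equiv.Perm (Fin 4),
        (∏ k, (X ((w₀ ∘ τ) k) : MvPolynomial (Fin 2) ℂ)) = X 0 ^ 2 * X 1 ^ 2 := by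
      intro τ
      rw [Fintype.prod_equiv τ (fun k => (X ((w₀ ∘ τ) k) : MvPolynomial (Fin 2) ℂ))
        (fun k => X (w₀ k)) (fun k => rfl)]
      simp only [Fin.prod_univ_four, w₀, Matrix.cons_val_zero, Matrix.cons_val_one,
        Matrix.cons_val]
      ring
    simp_rw [hw]
    rw [Finset.sum_const, Finset.card_univ, Fintype.card_perm, Fintype.card_fin, nsmul_eq_mul,
      map_mul, map_ofNat]
    norm_num [Nat.factorial]
    ring

/-- **Symmetry in the four slots.** [folklore] -/
private theorem quarticTensor_comp_perm (p r : ℂ) (π : Equiv.Perm (Fin 4)) (j : Fin 4 → Fin 2) :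
    quarticTensor p r (j ∘ π) = quarticTensor p r j := by
  rw [quarticTensor_apply, quarticTensor_apply]
  congr 1
  · refine Finset.sum_congr rfl fun i _ => ?_
    have hiff : (j ∘ π = fun _ : Fin 4 => i) ↔ (j = fun _ : Fin 4 => i) := by
      constructor
      · intro h
        funext x
        have := congr_fun h (π.symm x)
        simpa using this
      · intro h
        rw [h]
        rfl
    exact if_congr hiff rfl rfl
  · refine Fintype.sum_equiv (Equiv.mulRight π⁻¹) _ _ fun τ => ?_
    rw [Equiv.coe_mulRight]
    have hiff : (j ∘ π = w₀ ∘ τ) ↔ (j = w₀ ∘ ⇑(τ * π⁻¹)) := by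
      constructor
      · intro h
        funext x
        have := congr_fun h (π.symm x)
        simp only [Function.comp_apply, Equiv.apply_symm_apply] at this
        rw [this, Function.comp_apply, Equiv.Perm.coe_mul, Function.comp_apply, Equiv.Perm.inv_def]
      · intro h
        funext x
        rw [Function.comp_apply, h, Function.comp_apply, Function.comp_apply, Equiv.Perm.coe_mul,
          Function.comp_apply, Equiv.Perm.inv_def, Equiv.symm_apply_apply]
    exact if_congr hiff rfl rfl

/-- The letter swap of `ℂ²` acts on the word `0011` by a permutation of the slots (and so does
the identity): `ρ ∘ 0011 = 0011 ∘ τ₀`. [folklore] -/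
private theorem exists_perm_comp_w₀ (ρ : Equiv.Perm (Fin 2)) :
    ∃ τ₀ : Equiv.Perm (Fin 4), ρ ∘ w₀ = w₀ ∘ τ₀ := by
  have key : ∀ i : Fin 2, i = 0 ∨ i = 1 := by decide
  by_cases h0 : ρ 0 = 0
  · have h1 : ρ 1 = 1 := by
      rcases key (ρ 1) with h | h
      · exact absurd (ρ.injective (h.trans h0.symm)) (by decide)
      · exact h
    refine ⟨1, funext fun k => ?_⟩
    rcases key (w₀ k) with hk | hk
    · simp only [Function.comp_apply, hk, h0, Equiv.Perm.coe_one, id_eq]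
    · simp only [Function.comp_apply, hk, h1, Equiv.Perm.coe_one, id_eq]
  · have h0' : ρ 0 = 1 := (key (ρ 0)).resolve_left h0
    have h1 : ρ 1 = 0 := by
      rcases key (ρ 1) with h | h
      · exact h
      · exact absurd (ρ.injective (h.trans h0'.symm)) (by decide)
    refine ⟨Equiv.swap 0 2 * Equiv.swap 1 3, funext fun k => ?_⟩
    fin_cases k
    · simp only [w₀, Function.comp_apply, Equiv.Perm.coe_mul]; simp [h0', Equiv.swap_apply_def]
    · simp only [w₀, Function.comp_apply, Equiv.Perm.coe_mul]; simp [h0', Equiv.swap_apply_def]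
    · simp only [w₀, Function.comp_apply, Equiv.Perm.coe_mul]; simp [h1, Equiv.swap_apply_def]
    · simp only [w₀, Function.comp_apply, Equiv.Perm.coe_mul]; simp [h1, Equiv.swap_apply_def]

/-- **Invariance under relabelling the two letters.** [folklore] -/
private theorem quarticTensor_relabel (p r : ℂ) (ρ : Equiv.Perm (Fin 2)) (j : Fin 4 → Fin 2) :
    quarticTensor p r (ρ ∘ j) = quarticTensor p r j := by
  rw [quarticTensor_apply, quarticTensor_apply]
  congr 1
  · symm
    refine Fintype.sum_equiv ρ _ _ fun i => ?_
    have hiff : (j = fun _ : Fin 4 => i) ↔ (ρ ∘ j = fun _ : Fin 4 => ρ i) :=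
      ⟨fun h => by rw [h]; rfl, fun h => ρ.injective.comp_left h⟩
    exact if_congr hiff rfl rfl
  · obtain ⟨τ₀, hτ₀⟩ := exists_perm_comp_w₀ ρ.symm
    have hτ₀' : ∀ y, w₀ (τ₀ y) = ρ.symm (w₀ y) := fun y => (congr_fun hτ₀ y).symm
    refine Fintype.sum_equiv (Equiv.mulLeft τ₀) _ _ fun τ => ?_
    rw [Equiv.coe_mulLeft]
    have hiff : (ρ ∘ j = w₀ ∘ τ) ↔ (j = w₀ ∘ ⇑(τ₀ * τ)) := by
      constructor
      · intro h
        funext x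
        have hx := congr_fun h x
        simp only [Function.comp_apply] at hx
        rw [Function.comp_apply, Equiv.Perm.coe_mul, Function.comp_apply, hτ₀', ← hx,
          Equiv.symm_apply_apply]
      · intro h
        funext x
        rw [Function.comp_apply, h, Function.comp_apply, Equiv.Perm.coe_mul, Function.comp_apply,
          hτ₀', Equiv.apply_symm_apply, Function.comp_apply]
    exact if_congr hiff rfl rfl

/-- The support: a word on which the tensor is nonzero is constant or an `𝔖₄`-translate of `0011`.
[folklore] -/
private theorem quarticTensor_ne_zero_cases {p r : ℂ} {j : Fin 4 → Fin 2}
    (hj : quarticTensor p r j ≠ 0) :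
    (∃ i : Fin 2, j = fun _ => i) ∨ ∃ τ : Equiv.Perm (Fin 4), j = w₀ ∘ τ := by
  by_contra h
  push Not at h
  apply hj
  rw [quarticTensor_apply, Finset.sum_eq_zero fun i _ => if_neg (h.1 i),
    Finset.sum_eq_zero fun τ _ => if_neg (h.2 τ), add_zero]

/-- The number of letters `0` in a word of the support is even (`4, 0` or `2`). [folklore] -/
private theorem even_card_filter_of_ne_zero {p r : ℂ} {j : Fin 4 → Fin 2}
    (hj : quarticTensor p r j ≠ 0) :
    Even (Finset.univ.filter (fun k => j k = 0)).card := by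
  rcases quarticTensor_ne_zero_cases hj with ⟨i, rfl⟩ | ⟨τ, rfl⟩
  · by_cases hi : i = 0
    · rw [Finset.filter_true_of_mem (fun k _ => hi), Finset.card_univ, Fintype.card_fin]
      decide
    · rw [Finset.filter_false_of_mem (fun k _ => hi), Finset.card_empty]
      decide
  · have hcard : (Finset.univ.filter (fun k => (w₀ ∘ τ) k = 0)).card =
        (Finset.univ.filter (fun k => w₀ k = 0)).card := by
      rw [← Fintype.card_subtype, ← Fintype.card_subtype]
      exact Fintype.card_congr (Equiv.subtypeEquiv τ fun k => Iff.rfl)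
    rw [hcard]
    decide

/-- Counting letters `0` after changing one letter. [folklore] -/
private theorem card_filter_update (j : Fin 4 → Fin 2) (k : Fin 4) (b : Fin 2) :
    (Finset.univ.filter (fun k' => Function.update j k b k' = 0)).card +
        (if j k = 0 then 1 else 0) =
      (Finset.univ.filter (fun k' => j k' = 0)).card + (if b = 0 then 1 else 0) := by
  rw [Finset.card_filter, Finset.card_filter]
  have h1 : (fun k' => if Function.update j k b k' = 0 then 1 else 0) =
      Function.update (fun k' => if j k' = 0 then 1 else 0) k (if b = 0 then 1 else 0) := by
    funext k'
    exact Function.apply_update (fun _ (v : Fin 2) => if v = 0 then 1 else 0) j k b k'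
  rw [h1, Finset.sum_update_of_mem (Finset.mem_univ k),
    Finset.sum_eq_add_sum_sdiff_singleton_of_mem (Finset.mem_univ k) fun k' => if j k' = 0 then 1 else 0]
  ring

/-- **Rigidity of the support**: two support words cannot differ in exactly one slot (the number of
zeros would change by one, but it is even on the support). [folklore] -/
private theorem quarticTensor_rigid (p r : ℂ) (j : Fin 4 → Fin 2) (k : Fin 4) (b : Fin 2)
    (hj : quarticTensor p r j ≠ 0) (hj' : quarticTensor p r (Function.update j k b) ≠ 0) :
    b = j k := by
  by_contra hb
  have key : ∀ i : Fin 2, i = 0 ∨ i = 1 := by decide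
  obtain ⟨n, hn⟩ := even_card_filter_of_ne_zero hj
  obtain ⟨n', hn'⟩ := even_card_filter_of_ne_zero hj'
  have h := card_filter_update j k b
  rw [hn, hn'] at h
  rcases key b with hb0 | hb1 <;> rcases key (j k) with hk0 | hk1
  · exact hb (hb0.trans hk0.symm)
  · rw [if_neg (by rw [hk1]; decide), if_pos hb0] at h
    omega
  · rw [if_pos hk0, if_neg (by rw [hb1]; decide)] at h
    omega
  · exact hb (hb1.trans hk1.symm)

/-- **A polystable family of binary quartics**: every form `p (x⁴ + y⁴) + e x²y²` (`p, e ∈ ℂ`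
arbitrary) is polystable — its `SL₂`-orbit is Zariski closed. It is the polynomial shadow of the
symmetric tensor `quarticTensor p (e/24)`, whose support (constant words and the `𝔖₄`-orbit of
`0011`) is rigid and invariant under the letter swap, so the tree's Kempf–Ness criterion
`isPolystable_tensorToPoly_of_rigid_of_relabel` applies (OUR intermediate step; the route of the
printed proof of Cor. 2.9 via Prop. 2.8). [cite: BurgisserIkenmeyer2017, Prop. 2.8 and Cor. 2.9 (proof)] -/
theorem isPolystable_quarticFamily (p e : ℂ) :
    IsPolystable (C p * (X 0 ^ 4 + X 1 ^ 4) + C e * (X 0 ^ 2 * X 1 ^ 2) : MvPolynomial (Fin 2) ℂ) := by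
  have h := isPolystable_tensorToPoly_of_rigid_of_relabel (quarticTensor p (e / 24))
    (quarticTensor_comp_perm p (e / 24)) (quarticTensor_rigid p (e / 24))
    (quarticTensor_relabel p (e / 24))
  rwa [tensorToPoly_quarticTensor, mul_div_cancel₀ e (by norm_num : (24 : ℂ) ≠ 0)] at h

/-! ### §2 Four distinct lines: the normal form `x y (x + y) (p x + q y)` -/

/-- Evaluating a linear substitution: `(M · f)(x) = f(Mᵀ x)` (private copy, as in the sibling
proof files). [folklore] -/
private theorem eval_linSubst' (M : Matrix (Fin 2) (Fin 2) ℂ) (x : Fin 2 → ℂ)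
    (f : MvPolynomial (Fin 2) ℂ) : eval x (linSubst (Fin 2) ℂ M f) = eval (Mᵀ *ᵥ x) f := by
  induction f using MvPolynomial.induction_on with
  | C a => rw [linSubst_C, eval_C, eval_C]
  | add p q hp hq => rw [map_add, map_add, map_add, hp, hq]
  | mul_X p i hp =>
    rw [map_mul, map_mul, map_mul, hp, linSubst_X, eval_X]
    congr 1
    simp [mulVec, dotProduct, smul_eval]

/-- **Four distinct lines in normal position**: if `f = a ∏_{i<4} (x − r_i y)` with `a ≠ 0` and
pairwise distinct `r_i`, the explicit invertible `M = diag(r₁ − r₃, r₂ − r₃) · [[r₂, 1], [r₁, 1]]`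
gives `M · f = c · x y (x + y) (p x + q y)` with `c = −a (r₁−r₂)²(r₁−r₃)²(r₂−r₃)² ≠ 0`,
`p = (r₁−r₃)(r₂−r₄) ≠ 0`, `q = (r₂−r₃)(r₁−r₄) ≠ 0`, `p ≠ q` (`q − p = (r₁−r₂)(r₄−r₃)`); the ratio
`q / p` is the cross-ratio of the four roots. [cite: BurgisserIkenmeyer2017, Prop. 2.10 (case (D, m) = (4, 2))] -/
theorem exists_linSubst_prod_four_lines {f : MvPolynomial (Fin 2) ℂ} {a r₁ r₂ r₃ r₄ : ℂ} (ha : a ≠ 0)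
    (h12 : r₁ ≠ r₂) (h13 : r₁ ≠ r₃) (h14 : r₁ ≠ r₄) (h23 : r₂ ≠ r₃) (h24 : r₂ ≠ r₄) (h34 : r₃ ≠ r₄)
    (hf : f = C a * ((X 0 - C r₁ * X 1) * (X 0 - C r₂ * X 1) * (X 0 - C r₃ * X 1) *
      (X 0 - C r₄ * X 1))) :
    ∃ M : Matrix (Fin 2) (Fin 2) ℂ, M.det ≠ 0 ∧
      -(a * ((r₁ - r₂) * (r₁ - r₃) * (r₂ - r₃)) ^ 2) ≠ 0 ∧
      (r₁ - r₃) * (r₂ - r₄) ≠ 0 ∧ (r₂ - r₃) * (r₁ - r₄) ≠ 0 ∧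
      (r₁ - r₃) * (r₂ - r₄) ≠ (r₂ - r₃) * (r₁ - r₄) ∧
      linSubst (Fin 2) ℂ M f = C (-(a * ((r₁ - r₂) * (r₁ - r₃) * (r₂ - r₃)) ^ 2)) *
        (X 0 * X 1 * (X 0 + X 1) * (C ((r₁ - r₃) * (r₂ - r₄)) * X 0 + C ((r₂ - r₃) * (r₁ - r₄)) * X 1)) := by
  have hne : ∀ {u v : ℂ}, u ≠ v → u - v ≠ 0 := fun h => sub_ne_zero.mpr h
  refine ⟨!![(r₁ - r₃) * r₂, r₁ - r₃; (r₂ - r₃) * r₁, r₂ - r₃], ?_, ?_, ?_, ?_, ?_, ?_⟩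
  · rw [Matrix.det_fin_two_of]
    have : (r₁ - r₃) * r₂ * (r₂ - r₃) - (r₁ - r₃) * ((r₂ - r₃) * r₁) =
        -((r₁ - r₂) * (r₁ - r₃) * (r₂ - r₃)) := by ring
    rw [this, neg_ne_zero]
    exact mul_ne_zero (mul_ne_zero (hne h12) (hne h13)) (hne h23)
  · rw [neg_ne_zero]
    exact mul_ne_zero ha (pow_ne_zero 2 (mul_ne_zero (mul_ne_zero (hne h12) (hne h13)) (hne h23)))
  · exact mul_ne_zero (hne h13) (hne h24)
  · exact mul_ne_zero (hne h23) (hne h14)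
  · intro h
    have : (r₁ - r₂) * (r₄ - r₃) = 0 := by linear_combination -h
    rcases mul_eq_zero.mp this with h' | h'
    · exact h12 (sub_eq_zero.mp h')
    · exact h34 (sub_eq_zero.mp h').symm
  · apply MvPolynomial.funext
    intro u
    rw [eval_linSubst', hf]
    simp only [map_mul, map_sub, map_add, map_neg, eval_C, eval_X, mulVec, dotProduct,
      Fin.sum_univ_two, transpose_apply, of_apply, cons_val', cons_val_zero, cons_val_one,
      cons_val_fin_one, empty_val']
    ring

/-- Proportional normal forms: if `p₀ q = q₀ p` then `p₀ · N_{p,q} = p · N_{p₀,q₀}` for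
`N_{p,q} = x y (x + y) (p x + q y)`. [folklore] -/
private theorem normalForm_prop {p q p₀ q₀ : ℂ} (h : p₀ * q = q₀ * p) :
    C p₀ * (X 0 * X 1 * (X 0 + X 1) * (C p * X 0 + C q * X 1) : MvPolynomial (Fin 2) ℂ) =
      C p * (X 0 * X 1 * (X 0 + X 1) * (C p₀ * X 0 + C q₀ * X 1)) := by
  have hC : (C (p₀ * q) : MvPolynomial (Fin 2) ℂ) = C (q₀ * p) := by rw [h]
  rw [map_mul, map_mul] at hC
  linear_combination (X 0 * X 1 * (X 0 + X 1) * X 1 : MvPolynomial (Fin 2) ℂ) * hC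

/-! ### §3 Splitting a binary quartic -/

/-- An exponent vector on `Fin 2` is `(e 0, e 1)`. [folklore] -/
private theorem finsupp_fin_two_eq (e : Fin 2 →₀ ℕ) :
    e = Finsupp.single 0 (e 0) + Finsupp.single 1 (e 1) := by
  ext i
  fin_cases i <;> simp

/-- The five monomials of degree `4` in two variables. [folklore] -/
private theorem eq_of_degree_eq_four {e : Fin 2 →₀ ℕ} (he : e.degree = 4) :
    e = Finsupp.single 0 4 ∨ e = Finsupp.single 0 3 + Finsupp.single 1 1 ∨
      e = Finsupp.single 0 2 + Finsupp.single 1 2 ∨ e = Finsupp.single 0 1 + Finsupp.single 1 3 ∨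
      e = Finsupp.single 1 4 := by
  have h := he
  simp only [Finsupp.degree_eq_sum, Fin.sum_univ_two] at h
  have he0 : e 0 ≤ 4 := by omega
  rw [finsupp_fin_two_eq e]
  interval_cases h0 : e 0
  · have h1 : e 1 = 4 := by omega
    rw [h1, Finsupp.single_zero, zero_add]
    exact Or.inr (Or.inr (Or.inr (Or.inr rfl)))
  · have h1 : e 1 = 3 := by omega
    rw [h1]
    exact Or.inr (Or.inr (Or.inr (Or.inl rfl)))
  · have h1 : e 1 = 2 := by omega
    rw [h1]
    exact Or.inr (Or.inr (Or.inl rfl))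
  · have h1 : e 1 = 1 := by omega
    rw [h1]
    exact Or.inr (Or.inl rfl)
  · have h1 : e 1 = 0 := by omega
    rw [h1, Finsupp.single_zero, add_zero]
    exact Or.inl rfl

/-- Evaluation of a binary quartic at a point, in terms of its five coefficients. [folklore] -/
private theorem eval_eq_of_isHomogeneous_four {f : MvPolynomial (Fin 2) ℂ} (hf : f.IsHomogeneous 4)
    (u : Fin 2 → ℂ) :
    eval u f = coeff (Finsupp.single 0 4) f * u 0 ^ 4 +
      coeff (Finsupp.single 0 3 + Finsupp.single 1 1) f * (u 0 ^ 3 * u 1) +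
      coeff (Finsupp.single 0 2 + Finsupp.single 1 2) f * (u 0 ^ 2 * u 1 ^ 2) +
      coeff (Finsupp.single 0 1 + Finsupp.single 1 3) f * (u 0 * u 1 ^ 3) +
      coeff (Finsupp.single 1 4) f * u 1 ^ 4 := by
  classical
  -- pairwise distinctness, read off at the letter `0`
  have hne : ∀ {e e' : Fin 2 →₀ ℕ}, e 0 ≠ e' 0 → e ≠ e' := fun h heq => h (by rw [heq])
  set s₀ : Fin 2 →₀ ℕ := Finsupp.single 0 4 with hs₀
  set s₁ : Fin 2 →₀ ℕ := Finsupp.single 0 3 + Finsupp.single 1 1 with hs₁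
  set s₂ : Fin 2 →₀ ℕ := Finsupp.single 0 2 + Finsupp.single 1 2 with hs₂
  set s₃ : Fin 2 →₀ ℕ := Finsupp.single 0 1 + Finsupp.single 1 3 with hs₃
  set s₄ : Fin 2 →₀ ℕ := Finsupp.single 1 4 with hs₄
  have v₀ : s₀ 0 = 4 := by simp [hs₀]
  have v₁ : s₁ 0 = 3 := by simp [hs₁]
  have v₂ : s₂ 0 = 2 := by simp [hs₂]
  have v₃ : s₃ 0 = 1 := by simp [hs₃]
  have v₄ : s₄ 0 = 0 := by simp [hs₄]
  set S : Finset (Fin 2 →₀ ℕ) := {s₀, s₁, s₂, s₃, s₄} with hS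
  have hsub : f.support ⊆ S := by
    intro e he
    have hdeg : e.degree = 4 := by
      rw [Finsupp.degree_eq_weight_one]
      exact hf (mem_support_iff.mp he)
    rcases eq_of_degree_eq_four hdeg with h | h | h | h | h <;> simp [hS, h, hs₀, hs₁, hs₂, hs₃, hs₄]
  rw [eval_eq', Finset.sum_subset hsub (fun e _ he => by
    rw [notMem_support_iff.mp he, zero_mul])]
  rw [hS, Finset.sum_insert, Finset.sum_insert, Finset.sum_insert, Finset.sum_insert,
    Finset.sum_singleton]
  rotate_left
  · simp only [Finset.mem_singleton]
    exact hne (by rw [v₃, v₄]; decide)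
  · simp only [Finset.mem_insert, Finset.mem_singleton, not_or]
    exact ⟨hne (by rw [v₂, v₃]; decide), hne (by rw [v₂, v₄]; decide)⟩
  · simp only [Finset.mem_insert, Finset.mem_singleton, not_or]
    exact ⟨hne (by rw [v₁, v₂]; decide), hne (by rw [v₁, v₃]; decide), hne (by rw [v₁, v₄]; decide)⟩
  · simp only [Finset.mem_insert, Finset.mem_singleton, not_or]
    exact ⟨hne (by rw [v₀, v₁]; decide), hne (by rw [v₀, v₂]; decide), hne (by rw [v₀, v₃]; decide),
      hne (by rw [v₀, v₄]; decide)⟩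
  simp only [hs₀, hs₁, hs₂, hs₃, hs₄, Fin.prod_univ_two, Finsupp.coe_add, Pi.add_apply,
    Finsupp.single_eq_same, Finsupp.single_eq_of_ne (show (0 : Fin 2) ≠ 1 by decide),
    Finsupp.single_eq_of_ne (show (1 : Fin 2) ≠ 0 by decide)]
  ring

/-- The discriminant of the binary quartic `a x⁴ + b x³y + c x²y² + d xy³ + e y⁴`. [folklore] -/
private def quarticDisc (a b c d e : ℂ) : ℂ :=
  256 * a ^ 3 * e ^ 3 - 192 * a ^ 2 * b * d * e ^ 2 - 128 * a ^ 2 * c ^ 2 * e ^ 2 +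
    144 * a ^ 2 * c * d ^ 2 * e - 27 * a ^ 2 * d ^ 4 + 144 * a * b ^ 2 * c * e ^ 2 -
    6 * a * b ^ 2 * d ^ 2 * e - 80 * a * b * c ^ 2 * d * e + 18 * a * b * c * d ^ 3 +
    16 * a * c ^ 4 * e - 4 * a * c ^ 3 * d ^ 2 - 27 * b ^ 4 * e ^ 2 + 18 * b ^ 3 * c * d * e -
    4 * b ^ 3 * d ^ 3 - 4 * b ^ 2 * c ^ 3 * e + b ^ 2 * c ^ 2 * d ^ 2

/-- **Vieta and the discriminant**: `disc = a⁶ ∏_{i<j} (r_i − r_j)²`. [folklore] -/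
private theorem quarticDisc_eq_of_vieta {a b c d e r₁ r₂ r₃ r₄ : ℂ}
    (hb : b = -(a * (r₁ + r₂ + r₃ + r₄)))
    (hc : c = a * (r₁ * r₂ + r₁ * r₃ + r₁ * r₄ + r₂ * r₃ + r₂ * r₄ + r₃ * r₄))
    (hd : d = -(a * (r₁ * r₂ * r₃ + r₁ * r₂ * r₄ + r₁ * r₃ * r₄ + r₂ * r₃ * r₄)))
    (he : e = a * (r₁ * r₂ * r₃ * r₄)) :
    quarticDisc a b c d e =
      a ^ 6 * ((r₁ - r₂) * (r₁ - r₃) * (r₁ - r₄) * (r₂ - r₃) * (r₂ - r₄) * (r₃ - r₄)) ^ 2 := by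
  rw [quarticDisc, hb, hc, hd, he]
  ring

/-- **A binary quartic with `a ≠ 0` splits** as `a ∏ (x − r_i y)` with Vieta's relations (Mathlib's
`IsAlgClosed.splits` for the dehomogenised quartic). [folklore] -/
private theorem exists_eq_prod_linear {f : MvPolynomial (Fin 2) ℂ} (hf : f.IsHomogeneous 4)
    (ha : coeff (Finsupp.single 0 4) f ≠ 0) :
    ∃ r₁ r₂ r₃ r₄ : ℂ,
      coeff (Finsupp.single 0 3 + Finsupp.single 1 1) f =
          -(coeff (Finsupp.single 0 4) f * (r₁ + r₂ + r₃ + r₄)) ∧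
      coeff (Finsupp.single 0 2 + Finsupp.single 1 2) f =
          coeff (Finsupp.single 0 4) f * (r₁ * r₂ + r₁ * r₃ + r₁ * r₄ + r₂ * r₃ + r₂ * r₄ + r₃ * r₄) ∧
      coeff (Finsupp.single 0 1 + Finsupp.single 1 3) f =
          -(coeff (Finsupp.single 0 4) f * (r₁ * r₂ * r₃ + r₁ * r₂ * r₄ + r₁ * r₃ * r₄ + r₂ * r₃ * r₄)) ∧
      coeff (Finsupp.single 1 4) f = coeff (Finsupp.single 0 4) f * (r₁ * r₂ * r₃ * r₄) ∧
      f = C (coeff (Finsupp.single 0 4) f) *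
        ((X 0 - C r₁ * X 1) * (X 0 - C r₂ * X 1) * (X 0 - C r₃ * X 1) * (X 0 - C r₄ * X 1)) := by
  set a := coeff (Finsupp.single 0 4) f with ha'
  set b := coeff (Finsupp.single 0 3 + Finsupp.single 1 1) f with hb'
  set c := coeff (Finsupp.single 0 2 + Finsupp.single 1 2) f with hc'
  set d := coeff (Finsupp.single 0 1 + Finsupp.single 1 3) f with hd'
  set e := coeff (Finsupp.single 1 4) f with he'
  -- the dehomogenised quartic
  set p : Polynomial ℂ := Polynomial.C a * Polynomial.X ^ 4 + (Polynomial.C b * Polynomial.X ^ 3 +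
    Polynomial.C c * Polynomial.X ^ 2 + Polynomial.C d * Polynomial.X + Polynomial.C e) with hp
  have hlt : (Polynomial.C b * Polynomial.X ^ 3 + Polynomial.C c * Polynomial.X ^ 2 +
      Polynomial.C d * Polynomial.X + Polynomial.C e).degree < (Polynomial.C a * Polynomial.X ^ 4).degree := by
    rw [Polynomial.degree_C_mul_X_pow 4 ha]
    exact Polynomial.degree_cubic_lt
  have hdeg : p.natDegree = 4 := by
    apply Polynomial.natDegree_eq_of_degree_eq_some
    rw [hp, Polynomial.degree_add_eq_left_of_degree_lt hlt, Polynomial.degree_C_mul_X_pow 4 ha]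
  have hlead : p.leadingCoeff = a := by
    rw [hp, add_comm, Polynomial.leadingCoeff_add_of_degree_lt hlt, Polynomial.leadingCoeff_C_mul_X_pow]
  have hsplit : p.Splits := IsAlgClosed.splits p
  have hcard : p.roots.card = 4 := by rw [Polynomial.splits_iff_card_roots.mp hsplit, hdeg]
  -- four roots
  obtain ⟨r₁, t, ht⟩ : ∃ r t, p.roots = r ::ₘ t := by
    obtain ⟨r, hr⟩ := Multiset.card_pos_iff_exists_mem.mp (by rw [hcard]; norm_num)
    exact ⟨r, _, (Multiset.cons_erase hr).symm⟩
  have htcard : t.card = 3 := by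
    have := hcard
    rw [ht, Multiset.card_cons] at this
    omega
  obtain ⟨r₂, r₃, r₄, htroots⟩ := Multiset.card_eq_three.mp htcard
  have hprod := hsplit.eq_prod_roots
  rw [hlead, ht, htroots] at hprod
  simp only [Multiset.insert_eq_cons, Multiset.map_cons, Multiset.map_singleton, Multiset.prod_cons,
    Multiset.prod_singleton] at hprod
  -- Vieta by comparing coefficients
  have hexp : Polynomial.C a * ((Polynomial.X - Polynomial.C r₁) * ((Polynomial.X - Polynomial.C r₂) *
      ((Polynomial.X - Polynomial.C r₃) * (Polynomial.X - Polynomial.C r₄)))) =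
      Polynomial.C a * Polynomial.X ^ 4 + Polynomial.C (-(a * (r₁ + r₂ + r₃ + r₄))) * Polynomial.X ^ 3 +
        Polynomial.C (a * (r₁ * r₂ + r₁ * r₃ + r₁ * r₄ + r₂ * r₃ + r₂ * r₄ + r₃ * r₄)) * Polynomial.X ^ 2 +
        Polynomial.C (-(a * (r₁ * r₂ * r₃ + r₁ * r₂ * r₄ + r₁ * r₃ * r₄ + r₂ * r₃ * r₄))) * Polynomial.X +
        Polynomial.C (a * (r₁ * r₂ * r₃ * r₄)) := by
    simp only [map_neg, map_mul, map_add]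
    ring
  have hp' : p = Polynomial.C a * Polynomial.X ^ 4 + Polynomial.C b * Polynomial.X ^ 3 +
      Polynomial.C c * Polynomial.X ^ 2 + Polynomial.C d * Polynomial.X + Polynomial.C e := by
    rw [hp]
    ring
  rw [hexp, hp'] at hprod
  have hcoeff : ∀ (n : ℕ) (a' b' c' d' e' : ℂ),
      (Polynomial.C a' * Polynomial.X ^ 4 + Polynomial.C b' * Polynomial.X ^ 3 +
        Polynomial.C c' * Polynomial.X ^ 2 + Polynomial.C d' * Polynomial.X + Polynomial.C e').coeff n =
      (if n = 4 then a' else 0) + (if n = 3 then b' else 0) + (if n = 2 then c' else 0) +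
        (if n = 1 then d' else 0) + (if n = 0 then e' else 0) := by
    intro n a' b' c' d' e'
    simp only [Polynomial.coeff_add, Polynomial.coeff_C_mul_X_pow, Polynomial.coeff_C_mul_X,
      Polynomial.coeff_C]
  have hb : b = -(a * (r₁ + r₂ + r₃ + r₄)) := by
    have h := congrArg (fun q : Polynomial ℂ => q.coeff 3) hprod
    simp only [hcoeff] at h
    norm_num at h
    exact h
  have hc : c = a * (r₁ * r₂ + r₁ * r₃ + r₁ * r₄ + r₂ * r₃ + r₂ * r₄ + r₃ * r₄) := by
    have h := congrArg (fun q : Polynomial ℂ => q.coeff 2) hprod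
    simp only [hcoeff] at h
    norm_num at h
    exact h
  have hd : d = -(a * (r₁ * r₂ * r₃ + r₁ * r₂ * r₄ + r₁ * r₃ * r₄ + r₂ * r₃ * r₄)) := by
    have h := congrArg (fun q : Polynomial ℂ => q.coeff 1) hprod
    simp only [hcoeff] at h
    norm_num at h
    exact h
  have he : e = a * (r₁ * r₂ * r₃ * r₄) := by
    have h := congrArg (fun q : Polynomial ℂ => q.coeff 0) hprod
    simp only [hcoeff] at h
    norm_num at h
    exact h
  refine ⟨r₁, r₂, r₃, r₄, hb, hc, hd, he, ?_⟩
  apply MvPolynomial.funext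
  intro u
  rw [eval_eq_of_isHomogeneous_four hf u, ← ha', ← hb', ← hc', ← hd', ← he', hb, hc, hd, he]
  simp only [map_mul, map_sub, eval_C, eval_X]
  ring

/-! ### §4 Nondegenerate binary quartics are polystable -/

/-- **A binary quartic with `a ≠ 0` and non-zero discriminant is polystable.** Its four roots are
distinct, so `M · f = c · x y (x + y)(p x + q y)` (`exists_linSubst_prod_four_lines`); the polystable
quartic `Q_β = x⁴ − (β² + β⁻²) x²y² + y⁴ = (x² − β²y²)(x² − β⁻²y²)` (`isPolystable_quarticFamily`) has
the same normal form up to scalars as soon as `β` solves `(q − p) β⁴ − 2 (q + p) β² + (q − p) = 0`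
(equality of cross-ratios), so `f ∈ GL₂ · Q_β` and polystability is a property of `GL`-orbits
(`IsPolystable.linSubst_of_det_ne_zero`). [cite: BurgisserIkenmeyer2017, Prop. 2.10 (case (D, m) = (4, 2))] -/
theorem isPolystable_binaryQuartic {f : MvPolynomial (Fin 2) ℂ} (hf : f.IsHomogeneous 4)
    (ha : coeff (Finsupp.single 0 4) f ≠ 0)
    (hdisc : quarticDisc (coeff (Finsupp.single 0 4) f) (coeff (Finsupp.single 0 3 + Finsupp.single 1 1) f)
      (coeff (Finsupp.single 0 2 + Finsupp.single 1 2) f) (coeff (Finsupp.single 0 1 + Finsupp.single 1 3) f)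
      (coeff (Finsupp.single 1 4) f) ≠ 0) :
    IsPolystable f := by
  obtain ⟨r₁, r₂, r₃, r₄, hb, hc, hd, he, hfeq⟩ := exists_eq_prod_linear hf ha
  rw [quarticDisc_eq_of_vieta hb hc hd he] at hdisc
  have hprod := right_ne_zero_of_mul hdisc
  have hP : (r₁ - r₂) * (r₁ - r₃) * (r₁ - r₄) * (r₂ - r₃) * (r₂ - r₄) * (r₃ - r₄) ≠ 0 :=
    fun h => hprod (by rw [h, zero_pow two_ne_zero])
  have h12 : r₁ ≠ r₂ := fun h => hP (by rw [h]; ring)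
  have h13 : r₁ ≠ r₃ := fun h => hP (by rw [h]; ring)
  have h14 : r₁ ≠ r₄ := fun h => hP (by rw [h]; ring)
  have h23 : r₂ ≠ r₃ := fun h => hP (by rw [h]; ring)
  have h24 : r₂ ≠ r₄ := fun h => hP (by rw [h]; ring)
  have h34 : r₃ ≠ r₄ := fun h => hP (by rw [h]; ring)
  obtain ⟨M, hM, hc0, hp0, hq0, hpq, hMf⟩ :=
    exists_linSubst_prod_four_lines ha h12 h13 h14 h23 h24 h34 hfeq
  set cf : ℂ := -(coeff (Finsupp.single 0 4) f * ((r₁ - r₂) * (r₁ - r₃) * (r₂ - r₃)) ^ 2) with hcf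
  set p : ℂ := (r₁ - r₃) * (r₂ - r₄) with hpdef
  set q : ℂ := (r₂ - r₃) * (r₁ - r₄) with hqdef
  -- a root `β` of `(q - p) T⁴ - 2 (q + p) T² + (q - p)`
  have hqp : q - p ≠ 0 := sub_ne_zero.mpr (Ne.symm hpq)
  obtain ⟨β, hβ⟩ := IsAlgClosed.exists_root
    (Polynomial.C (q - p) * Polynomial.X ^ 4 + (Polynomial.C (-(2 * (q + p))) * Polynomial.X ^ 2 +
      Polynomial.C (q - p))) (by
      have hlt : (Polynomial.C (-(2 * (q + p))) * Polynomial.X ^ 2 + Polynomial.C (q - p)).degree <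
          (Polynomial.C (q - p) * Polynomial.X ^ 4 : Polynomial ℂ).degree := by
        rw [Polynomial.degree_C_mul_X_pow 4 hqp]
        refine lt_of_le_of_lt (Polynomial.degree_add_le _ _) (max_lt ?_ ?_)
        · exact lt_of_le_of_lt (Polynomial.degree_C_mul_X_pow_le 2 _) (by decide)
        · exact lt_of_le_of_lt Polynomial.degree_C_le (by decide)
      rw [Polynomial.degree_add_eq_left_of_degree_lt hlt, Polynomial.degree_C_mul_X_pow 4 hqp]
      decide)
  have hβeq : (q - p) * β ^ 4 - 2 * (q + p) * β ^ 2 + (q - p) = 0 := by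
    have h := hβ
    simp only [Polynomial.IsRoot, Polynomial.eval_add, Polynomial.eval_mul, Polynomial.eval_C,
      Polynomial.eval_pow, Polynomial.eval_X] at h
    linear_combination h
  have hβ0 : β ≠ 0 := by
    rintro rfl
    apply hqp
    linear_combination hβeq
  have hβ1 : β ^ 2 ≠ 1 := by
    intro h1
    apply hp0
    have h4 : β ^ 4 = 1 := by rw [show β ^ 4 = (β ^ 2) ^ 2 by ring, h1, one_pow]
    rw [h4, h1] at hβeq
    linear_combination -hβeq / 4
  have hβ2 : β ^ 2 ≠ -1 := by
    intro h1
    apply hq0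
    have h4 : β ^ 4 = 1 := by rw [show β ^ 4 = (β ^ 2) ^ 2 by ring, h1]; norm_num
    rw [h4, h1] at hβeq
    linear_combination hβeq / 4
  -- the polystable representative `Q_β` and its four distinct roots `β, -β, β⁻¹, -β⁻¹`
  set Q : MvPolynomial (Fin 2) ℂ := C 1 * ((X 0 - C β * X 1) * (X 0 - C (-β) * X 1) *
    (X 0 - C β⁻¹ * X 1) * (X 0 - C (-β⁻¹) * X 1)) with hQ
  have hQfam : Q = C 1 * (X 0 ^ 4 + X 1 ^ 4) + C (-(β ^ 2 + (β⁻¹) ^ 2)) * (X 0 ^ 2 * X 1 ^ 2) := by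
    apply MvPolynomial.funext
    intro u
    simp only [hQ, map_mul, map_sub, map_add, map_neg, map_one, map_pow, eval_C, eval_X]
    field_simp
    ring
  have hQps : IsPolystable Q := by
    rw [hQfam]
    exact isPolystable_quarticFamily 1 _
  have s12 : β ≠ -β := fun h => hβ0 (by linear_combination h / 2)
  have s13 : β ≠ β⁻¹ := by
    intro h
    apply hβ1
    calc β ^ 2 = β * β := sq β
      _ = β * β⁻¹ := by rw [← h]
      _ = 1 := mul_inv_cancel₀ hβ0
  have s14 : β ≠ -β⁻¹ := by
    intro h
    apply hβ2
    calc β ^ 2 = β * β := sq β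
      _ = -β⁻¹ * β := by rw [← h]
      _ = -1 := by rw [neg_mul, inv_mul_cancel₀ hβ0]
  have s23 : -β ≠ β⁻¹ := by
    intro h
    apply hβ2
    have : -β * β = 1 := by rw [h, inv_mul_cancel₀ hβ0]
    linear_combination -this
  have s24 : -β ≠ -β⁻¹ := fun h => s13 (neg_injective h)
  have s34 : β⁻¹ ≠ -β⁻¹ := fun h => inv_ne_zero hβ0 (by linear_combination h / 2)
  obtain ⟨M₀, hM₀, hc₀, hp₀, hq₀, -, hM₀Q⟩ :=
    exists_linSubst_prod_four_lines (f := Q) one_ne_zero s12 s13 s14 s23 s24 s34 hQ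
  set c₀ : ℂ := -(1 * ((β - -β) * (β - β⁻¹) * (-β - β⁻¹)) ^ 2) with hc₀def
  set p₀ : ℂ := (β - β⁻¹) * (-β - -β⁻¹) with hp₀def
  set q₀ : ℂ := (-β - β⁻¹) * (β - -β⁻¹) with hq₀def
  -- equal cross-ratios: `p₀ q = q₀ p`
  have hmatch : p₀ * q = q₀ * p := by
    have : p₀ * q - q₀ * p = -(β⁻¹) ^ 2 * ((q - p) * β ^ 4 - 2 * (q + p) * β ^ 2 + (q - p)) := by
      rw [hp₀def, hq₀def]
      field_simp
      ring
    rw [hβeq, mul_zero, sub_eq_zero] at this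
    exact this
  -- `M · f = κ · (M₀ · Q)` with `κ = c_f p / (c₀ p₀)`
  set κ : ℂ := cf * p / (c₀ * p₀) with hκ
  have hκ0 : κ ≠ 0 := div_ne_zero (mul_ne_zero hc0 hp0) (mul_ne_zero hc₀ hp₀)
  have hN := normalForm_prop hmatch
  have hkey : linSubst (Fin 2) ℂ M f = κ • linSubst (Fin 2) ℂ M₀ Q := by
    rw [hMf, hM₀Q, smul_eq_C_mul]
    have h2 : cf / p₀ * p = κ * c₀ := by
      rw [hκ]
      field_simp
    have hC1 : (C cf : MvPolynomial (Fin 2) ℂ) = C (cf / p₀) * C p₀ := by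
      rw [← map_mul, div_mul_cancel₀ cf hp₀]
    have hC2 : (C (cf / p₀) * C p : MvPolynomial (Fin 2) ℂ) = C κ * C c₀ := by
      rw [← map_mul, ← map_mul, h2]
    linear_combination (X 0 * X 1 * (X 0 + X 1) * (C p * X 0 + C q * X 1)) * hC1 +
      C (cf / p₀) * hN + (X 0 * X 1 * (X 0 + X 1) * (C p₀ * X 0 + C q₀ * X 1)) * hC2
  -- a fourth root of `κ`, and `f = M⁻¹ (μ M₀) · Q`
  obtain ⟨μ, hμ⟩ := IsAlgClosed.exists_pow_nat_eq κ (by norm_num : 0 < 4)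
  have hμ0 : μ ≠ 0 := by
    rintro rfl
    rw [zero_pow four_ne_zero] at hμ
    exact hκ0 hμ.symm
  have hQhom : Q.IsHomogeneous 4 := by
    rw [hQfam]
    exact (((isHomogeneous_X_pow (0 : Fin 2) 4).add (isHomogeneous_X_pow 1 4)).C_mul 1).add
      (((isHomogeneous_X_pow (0 : Fin 2) 2).mul (isHomogeneous_X_pow 1 2)).C_mul _)
  have hfin : f = linSubst (Fin 2) ℂ (M⁻¹ * (μ • M₀)) Q := by
    have hMinv : M⁻¹ * M = 1 := Matrix.nonsing_inv_mul M (isUnit_iff_ne_zero.mpr hM)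
    rw [linSubst_mul, AlgHom.comp_apply, linSubst_smul_of_isHomogeneous hQhom, hμ, ← hkey,
      ← AlgHom.comp_apply, ← linSubst_mul, hMinv, linSubst_one, AlgHom.id_apply]
  rw [hfin]
  refine hQps.linSubst_of_det_ne_zero ?_
  rw [det_mul, det_smul, Fintype.card_fin]
  refine mul_ne_zero ?_ (mul_ne_zero (pow_ne_zero 2 hμ0) hM₀)
  rw [Matrix.det_nonsing_inv, Ring.inverse_eq_inv']
  exact inv_ne_zero hM

end BinaryQuartic

open BinaryQuartic in
/-- **BI 2017, Prop. 2.10 at `(D, m) = (4, 2)`: almost all binary quartics are polystable.**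
`IsZariskiGeneric 4 IsPolystable` on `Sym⁴ ℂ²`, with the test polynomial `A · Disc(A, B, C, D, E)` in the
five coefficients (`A, E` the coefficients of `x⁴, y⁴`; value `256` at `x⁴ + y⁴`): off its zero set a
binary quartic has four distinct roots and lies in the `GL₂`-orbit of a member of the polystable
family `x⁴ + t x²y² + y⁴` (`isPolystable_binaryQuartic`). The general `D ≥ 3`, `m ≥ 2` body of
Prop. 2.10 (Thm. 2.3 + Luna 1973) is NOT proved here.
[cite: BurgisserIkenmeyer2017, Prop. 2.10 (case (D, m) = (4, 2), TeX L633–640)] -/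
theorem BI2017_prop_2_10_four_two :
    IsZariskiGeneric 4 (IsPolystable : MvPolynomial (Fin 2) ℂ → Prop) := by
  have hA : (Finsupp.single 0 4 : Fin 2 →₀ ℕ) ∈ degMonomials (Fin 2) 4 := by
    rw [mem_degMonomials_iff, Finsupp.degree_single]
  have hB : (Finsupp.single 0 3 + Finsupp.single 1 1 : Fin 2 →₀ ℕ) ∈ degMonomials (Fin 2) 4 := by
    rw [mem_degMonomials_iff, map_add, Finsupp.degree_single, Finsupp.degree_single]
  have hC : (Finsupp.single 0 2 + Finsupp.single 1 2 : Fin 2 →₀ ℕ) ∈ degMonomials (Fin 2) 4 := by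
    rw [mem_degMonomials_iff, map_add, Finsupp.degree_single, Finsupp.degree_single]
  have hD : (Finsupp.single 0 1 + Finsupp.single 1 3 : Fin 2 →₀ ℕ) ∈ degMonomials (Fin 2) 4 := by
    rw [mem_degMonomials_iff, map_add, Finsupp.degree_single, Finsupp.degree_single]
  have hE : (Finsupp.single 1 4 : Fin 2 →₀ ℕ) ∈ degMonomials (Fin 2) 4 := by
    rw [mem_degMonomials_iff, Finsupp.degree_single]
  set A : MvPolynomial (DegIdx (Fin 2) 4) ℂ := X ⟨_, hA⟩ with hAdef
  set B : MvPolynomial (DegIdx (Fin 2) 4) ℂ := X ⟨_, hB⟩ with hBdef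
  set Cc : MvPolynomial (DegIdx (Fin 2) 4) ℂ := X ⟨_, hC⟩ with hCdef
  set Dd : MvPolynomial (DegIdx (Fin 2) 4) ℂ := X ⟨_, hD⟩ with hDdef
  set Ee : MvPolynomial (DegIdx (Fin 2) 4) ℂ := X ⟨_, hE⟩ with hEdef
  have hval : ∀ f : MvPolynomial (Fin 2) ℂ,
      aeval (formCoeff 4 f) A = coeff (Finsupp.single 0 4) f ∧
      aeval (formCoeff 4 f) B = coeff (Finsupp.single 0 3 + Finsupp.single 1 1) f ∧
      aeval (formCoeff 4 f) Cc = coeff (Finsupp.single 0 2 + Finsupp.single 1 2) f ∧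
      aeval (formCoeff 4 f) Dd = coeff (Finsupp.single 0 1 + Finsupp.single 1 3) f ∧
      aeval (formCoeff 4 f) Ee = coeff (Finsupp.single 1 4) f := fun f => by
    refine ⟨?_, ?_, ?_, ?_, ?_⟩ <;> simp only [hAdef, hBdef, hCdef, hDdef, hEdef, aeval_X, formCoeff_apply]
  refine ⟨A * (256 * A ^ 3 * Ee ^ 3 - 192 * A ^ 2 * B * Dd * Ee ^ 2 - 128 * A ^ 2 * Cc ^ 2 * Ee ^ 2 +
      144 * A ^ 2 * Cc * Dd ^ 2 * Ee - 27 * A ^ 2 * Dd ^ 4 + 144 * A * B ^ 2 * Cc * Ee ^ 2 -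
      6 * A * B ^ 2 * Dd ^ 2 * Ee - 80 * A * B * Cc ^ 2 * Dd * Ee + 18 * A * B * Cc * Dd ^ 3 +
      16 * A * Cc ^ 4 * Ee - 4 * A * Cc ^ 3 * Dd ^ 2 - 27 * B ^ 4 * Ee ^ 2 + 18 * B ^ 3 * Cc * Dd * Ee -
      4 * B ^ 3 * Dd ^ 3 - 4 * B ^ 2 * Cc ^ 3 * Ee + B ^ 2 * Cc ^ 2 * Dd ^ 2), ?_, fun f hf hF => ?_⟩
  · -- nonzero: value `256` at `x⁴ + y⁴`
    intro h
    set f₀ : MvPolynomial (Fin 2) ℂ := X 0 ^ 4 + X 1 ^ 4 with hf₀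
    have hne : ∀ {e e' : Fin 2 →₀ ℕ}, e 0 ≠ e' 0 → e ≠ e' := fun h heq => h (by rw [heq])
    have v0 : (Finsupp.single 0 4 : Fin 2 →₀ ℕ) 0 = 4 := by simp
    have v1 : (Finsupp.single 0 3 + Finsupp.single 1 1 : Fin 2 →₀ ℕ) 0 = 3 := by simp
    have v2 : (Finsupp.single 0 2 + Finsupp.single 1 2 : Fin 2 →₀ ℕ) 0 = 2 := by simp
    have v3 : (Finsupp.single 0 1 + Finsupp.single 1 3 : Fin 2 →₀ ℕ) 0 = 1 := by simp
    have v4 : (Finsupp.single 1 4 : Fin 2 →₀ ℕ) 0 = 0 := by simp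
    have ca : coeff (Finsupp.single 0 4) f₀ = 1 := by
      rw [hf₀, coeff_add, coeff_X_pow, coeff_X_pow, if_pos rfl, if_neg (hne (by rw [v4, v0]; decide)),
        add_zero]
    have cb : coeff (Finsupp.single 0 3 + Finsupp.single 1 1) f₀ = 0 := by
      rw [hf₀, coeff_add, coeff_X_pow, coeff_X_pow, if_neg (hne (by rw [v0, v1]; decide)),
        if_neg (hne (by rw [v4, v1]; decide)), add_zero]
    have cc : coeff (Finsupp.single 0 2 + Finsupp.single 1 2) f₀ = 0 := by
      rw [hf₀, coeff_add, coeff_X_pow, coeff_X_pow, if_neg (hne (by rw [v0, v2]; decide)),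
        if_neg (hne (by rw [v4, v2]; decide)), add_zero]
    have cd : coeff (Finsupp.single 0 1 + Finsupp.single 1 3) f₀ = 0 := by
      rw [hf₀, coeff_add, coeff_X_pow, coeff_X_pow, if_neg (hne (by rw [v0, v3]; decide)),
        if_neg (hne (by rw [v4, v3]; decide)), add_zero]
    have ce : coeff (Finsupp.single 1 4) f₀ = 1 := by
      rw [hf₀, coeff_add, coeff_X_pow, coeff_X_pow, if_neg (hne (by rw [v0, v4]; decide)), if_pos rfl,
        zero_add]
    obtain ⟨vA, vB, vC, vD, vE⟩ := hval f₀
    have := congrArg (aeval (formCoeff 4 f₀)) h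
    simp only [map_mul, map_sub, map_add, map_pow, vA, vB, vC, vD, vE, ca, cb, cc, cd, ce, map_ofNat,
      map_zero] at this
    norm_num at this
  · obtain ⟨vA, vB, vC, vD, vE⟩ := hval f
    simp only [map_mul, map_sub, map_add, map_pow, vA, vB, vC, vD, vE, map_ofNat] at hF
    have ha : coeff (Finsupp.single 0 4) f ≠ 0 := by
      intro h0
      apply hF
      rw [h0, zero_mul]
    refine isPolystable_binaryQuartic hf ha fun h0 => hF ?_
    rw [quarticDisc] at h0
    rw [h0, mul_zero]

/-- **Exact residual of Prop. 2.10 after the three slice files**: the named fact follows from its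
instances with `m ≥ 3` (all `D ≥ 3`) together with the binary forms of degree `D ≥ 5` — none of
which is proved in the tree (printed proof: Thm. 2.3 + Luna 1973); `D = 2`, `m ≤ 1`, and the binary
cubics and quartics are theorems. [cite: BurgisserIkenmeyer2017, Prop. 2.10] -/
theorem BI2017_prop_2_10_of_main''
    (h : ∀ (D m : ℕ), 3 ≤ D → 2 ≤ m → (m = 2 → 5 ≤ D) →
      IsZariskiGeneric D (IsPolystable : MvPolynomial (Fin m) ℂ → Prop)) :
    BI2017_prop_2_10 := by
  refine BI2017_prop_2_10_of_main' fun D m hD hm h32 => ?_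
  by_cases h42 : (D, m) = (4, 2)
  · obtain ⟨rfl, rfl⟩ : D = 4 ∧ m = 2 := by simpa using h42
    exact BI2017_prop_2_10_four_two
  · refine h D m hD hm fun hm2 => ?_
    subst hm2
    by_contra hlt
    have hD' : D = 3 ∨ D = 4 := by omega
    rcases hD' with rfl | rfl
    · exact h32 rfl
    · exact h42 rfl

end Literature.Computability.AlgebraicComplexity

end
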